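import Summits.Ventures.PercRepro.S1CoreCapEightFourNT2

/-!
# PercRepro — TOWARDS `Q*(8)`: FOUR BIG LINES WITHOUT A TRIANGLE ADMIT NO TRANSVERSAL (p1, gen 27)

The last third of the no-triangle half of `FourBigBound₈`. With a meeting pair `A ∩ B = {p}` the facts of
`meets_all_of_meet` and the four instances of `vertex_not_mem` (`p ∉ C ∪ D`, `q = C ∩ D ∉ A ∪ B`) make the
meeting graph a 4-cycle: `|C ∩ A| + |C ∩ B| = |D ∩ A| + |D ∩ B| = |A ∩ D| + |A ∩ C| = |B ∩ D| + |B ∩ C| = 1`,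
so either `C–A, D–B` (`four_cycle`) or `C–B, D–A`. A 3-point line `X` meeting all four lines passes through a
vertex of the cycle (`exists_vertex`: four pairwise disjoint singletons would give `X` four points), and for
each of the four vertices an ordering with `X` first costs only `8` — against `cost_X_first`
(`no_transversal_cycle`, the cycle `C–A, D–B`; the other cycle by `C ↔ D`). `no_transversal_of_meet` and
`no_transversal_of_no_triangle` assemble: **four simple 4-point lines with no triangle admit no 3-point line
inside their union**, so such a configuration has cap exactly `16` (`four_big_bound_of_no_triangle`).
`proofs/P1-S4-CAPBRIDGE.md` §19 ADDENDUM 2. Axioms: standard.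
-/

namespace PercRepro

namespace S1

namespace FourCap

namespace Eight

open Seven

variable {β : Type} [DecidableEq β]

/-- Two traces of `X` on lines with no common point of `X` are disjoint. -/
theorem disjoint_trace_of_card {X M N : Finset β} (h : (X ∩ M ∩ N).card = 0) : Disjoint (X ∩ M) (X ∩ N) := by
  rw [Finset.disjoint_left]
  intro v hv1 hv2
  have : v ∈ X ∩ M ∩ N := Finset.mem_inter.2 ⟨hv1, (Finset.mem_inter.1 hv2).2⟩
  have := Finset.card_pos.2 ⟨v, this⟩
  omega

section Cycle

variable {w : β → ℕ} {ls : Finset (Finset β)}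
  (h1 : ∀ L ∈ ls, ∀ v ∈ L, w v = 1 ∨ w v = 2)
  (h2 : ∀ L ∈ ls, 3 ≤ L.card ∧ wsum w L ≤ 5)
  (h3 : ∀ L ∈ ls, ∀ L' ∈ ls, L ≠ L' → (L ∩ L').card ≤ 1)
  (h4 : ∀ l : List (Finset β), l.Nodup → (∀ L ∈ l, L ∈ ls) → wsum w (unionL l) ≤ 8 + lineRank l)

/-- **`X` passes through a vertex**: a 3-point line meeting four lines once each, inside their union, has a
point on two of them. -/
theorem exists_vertex {X A B C D : Finset β} (cX : X.card = 3) (hXsub : X ⊆ D ∪ (C ∪ (B ∪ A)))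
    (xA : (X ∩ A).card = 1) (xB : (X ∩ B).card = 1) (xC : (X ∩ C).card = 1) (xD : (X ∩ D).card = 1) :
    1 ≤ (X ∩ A ∩ B).card ∨ 1 ≤ (X ∩ A ∩ C).card ∨ 1 ≤ (X ∩ A ∩ D).card ∨ 1 ≤ (X ∩ B ∩ C).card ∨
      1 ≤ (X ∩ B ∩ D).card ∨ 1 ≤ (X ∩ C ∩ D).card := by
  by_contra hc
  push Not at hc
  obtain ⟨tAB, tAC, tAD, tBC, tBD, tCD⟩ := hc
  have u1 : (X ∩ (A ∪ B)).card = 2 := by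
    rw [Finset.inter_union_distrib_left, Finset.card_union_of_disjoint (disjoint_trace_of_card (by omega))]
    omega
  have u2 : (X ∩ (A ∪ B ∪ C)).card = 3 := by
    rw [Finset.inter_union_distrib_left (s := X) (t := A ∪ B) (u := C), Finset.card_union_of_disjoint]
    · omega
    · rw [Finset.inter_union_distrib_left, Finset.disjoint_union_left]
      exact ⟨disjoint_trace_of_card (by omega), disjoint_trace_of_card (by omega)⟩
  have u3 : (X ∩ (A ∪ B ∪ C ∪ D)).card = 4 := by
    rw [Finset.inter_union_distrib_left (s := X) (t := A ∪ B ∪ C) (u := D), Finset.card_union_of_disjoint]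
    · omega
    · rw [Finset.inter_union_distrib_left, Finset.inter_union_distrib_left, Finset.disjoint_union_left,
        Finset.disjoint_union_left]
      exact ⟨⟨disjoint_trace_of_card (by omega), disjoint_trace_of_card (by omega)⟩,
        disjoint_trace_of_card (by omega)⟩
  have hXe : X ∩ (A ∪ B ∪ C ∪ D) = X := by
    apply Finset.inter_eq_left.2
    intro v hv
    have := hXsub hv
    simp only [Finset.mem_union] at this ⊢
    tauto
  rw [hXe] at u3
  omega

include h1 h2 h3 h4 in
/-- **The cycle `A–B`, `B–D`, `D–C`, `C–A` admits no transversal**: for each vertex on `X` an ordering after `X`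
has `old₃ ≤ 2` and `old₄ ≤ 2`. -/
theorem no_transversal_cycle {X A B C D : Finset β} (hX : X ∈ ls) (hA : A ∈ ls) (hB : B ∈ ls) (hC : C ∈ ls)
    (hD : D ∈ ls) (hAX : A ≠ X) (hBX : B ≠ X) (hCX : C ≠ X) (hDX : D ≠ X) (hBA : B ≠ A) (hCA : C ≠ A)
    (hDA : D ≠ A) (hCB : C ≠ B) (hDB : D ≠ B) (hDC : D ≠ C) (cX : X.card = 3) (fX : fat w X = 0)
    (cA : A.card = 4) (cB : B.card = 4) (cC : C.card = 4) (cD : D.card = 4) (fA : fat w A = 0)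
    (fB : fat w B = 0) (fC : fat w C = 0) (hXsub : X ⊆ D ∪ (C ∪ (B ∪ A)))
    (eBA : (B ∩ A).card = 1) (eDC : (D ∩ C).card = 1) (eCA : (C ∩ A).card = 1) (eCB : (C ∩ B).card = 0)
    (eDA : (D ∩ A).card = 0) (eDB : (D ∩ B).card = 1)
    (xA : (X ∩ A).card = 1) (xB : (X ∩ B).card = 1) (xC : (X ∩ C).card = 1) (xD : (X ∩ D).card = 1) :
    False := by
  have iAD : (A ∩ D).card = (D ∩ A).card := by rw [Finset.inter_comm]
  have iBC : (B ∩ C).card = (C ∩ B).card := by rw [Finset.inter_comm]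
  have iAC : (A ∩ C).card = (C ∩ A).card := by rw [Finset.inter_comm]
  have iBD : (B ∩ D).card = (D ∩ B).card := by rw [Finset.inter_comm]
  have iCD : (C ∩ D).card = (D ∩ C).card := by rw [Finset.inter_comm]
  have iAB : (A ∩ B).card = (B ∩ A).card := by rw [Finset.inter_comm]
  have iAX : (A ∩ X).card = (X ∩ A).card := by rw [Finset.inter_comm]
  have iBX : (B ∩ X).card = (X ∩ B).card := by rw [Finset.inter_comm]
  have iCX : (C ∩ X).card = (X ∩ C).card := by rw [Finset.inter_comm]
  have iDX : (D ∩ X).card = (X ∩ D).card := by rw [Finset.inter_comm]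
  -- `X ∩ A ∩ D = ∅` and `X ∩ B ∩ C = ∅` (disjoint pairs)
  have tAD : (X ∩ A ∩ D).card = 0 := by
    have : (X ∩ A ∩ D).card ≤ (A ∩ D).card := Finset.card_le_card (fun v hv => Finset.mem_inter.2
      ⟨(Finset.mem_inter.1 (Finset.mem_inter.1 hv).1).2, (Finset.mem_inter.1 hv).2⟩)
    omega
  have tBC : (X ∩ B ∩ C).card = 0 := by
    have : (X ∩ B ∩ C).card ≤ (B ∩ C).card := Finset.card_le_card (fun v hv => Finset.mem_inter.2
      ⟨(Finset.mem_inter.1 (Finset.mem_inter.1 hv).1).2, (Finset.mem_inter.1 hv).2⟩)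
    omega
  -- the three-set inclusion–exclusion identities used below
  have e1 := card_inter_union_add B A X
  have e2 := card_inter_union_add D C X
  have e3 := card_inter_union_add C A X
  have e4 := card_inter_union_add D B X
  have iBAX : (B ∩ A ∩ X).card = (X ∩ A ∩ B).card := by
    congr 1; ext v; simp only [Finset.mem_inter]; tauto
  have iDCX : (D ∩ C ∩ X).card = (X ∩ C ∩ D).card := by
    congr 1; ext v; simp only [Finset.mem_inter]; tauto
  have iCAX : (C ∩ A ∩ X).card = (X ∩ A ∩ C).card := by
    congr 1; ext v; simp only [Finset.mem_inter]; tauto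
  have iDBX : (D ∩ B ∩ X).card = (X ∩ B ∩ D).card := by
    congr 1; ext v; simp only [Finset.mem_inter]; tauto
  rcases exists_vertex cX hXsub xA xB xC xD with hv | hv | hv | hv | hv | hv
  · -- `p = A ∩ B ∈ X`: the ordering `A, C, D, B`
    rcases cost_X_first h1 h2 h3 h4 hX hA hC hD hB hAX hCX hDX hBX hCA hDA hBA hDC hCB.symm hDB.symm cX fX cA cC
      cD cB fA fC with h | h
    · have := card_inter_union_le D C (A ∪ X)
      have := card_inter_union_le D A X
      omega
    · have := card_inter_union_le B D (C ∪ (A ∪ X))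
      have := card_inter_union_le B C (A ∪ X)
      omega
  · -- `r = A ∩ C ∈ X`: the ordering `A, B, D, C`
    rcases cost_X_first h1 h2 h3 h4 hX hA hB hD hC hAX hBX hDX hCX hBA hDA hCA hDB hCB hDC.symm cX fX cA cB cD
      cC fA fB with h | h
    · have := card_inter_union_le D B (A ∪ X)
      have := card_inter_union_le D A X
      omega
    · have := card_inter_union_le C D (B ∪ (A ∪ X))
      have := card_inter_union_le C B (A ∪ X)
      omega
  · -- `A ∩ D = ∅`
    omega
  · -- `B ∩ C = ∅`
    omega
  · -- `s = B ∩ D ∈ X`: the ordering `B, A, C, D`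
    rcases cost_X_first h1 h2 h3 h4 hX hB hA hC hD hBX hAX hCX hDX hBA.symm hCB hDB hCA hDA hDC cX fX cB cA cC
      cD fB fA with h | h
    · have := card_inter_union_le C A (B ∪ X)
      have := card_inter_union_le C B X
      omega
    · have := card_inter_union_le D C (A ∪ (B ∪ X))
      have := card_inter_union_le D A (B ∪ X)
      omega
  · -- `q = C ∩ D ∈ X`: the ordering `C, A, B, D`
    rcases cost_X_first h1 h2 h3 h4 hX hC hA hB hD hCX hAX hBX hDX hCA.symm hCB.symm hDC hBA hDA hDB cX fX cC cA
      cB cD fC fA with h | h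
    · have := card_inter_union_le B A (C ∪ X)
      have := card_inter_union_le B C X
      omega
    · have := card_inter_union_le D B (A ∪ (C ∪ X))
      have := card_inter_union_le D A (C ∪ X)
      omega

include h1 h2 h3 h4 in
/-- **A meeting pair and no triangle: no transversal.** -/
theorem no_transversal_of_meet (hnt : NoTriangle ls) {X A B C D : Finset β} (hX : X ∈ ls) (hA : A ∈ ls)
    (hB : B ∈ ls) (hC : C ∈ ls) (hD : D ∈ ls) (hAX : A ≠ X) (hBX : B ≠ X) (hCX : C ≠ X) (hDX : D ≠ X)
    (hBA : B ≠ A) (hCA : C ≠ A) (hDA : D ≠ A) (hCB : C ≠ B) (hDB : D ≠ B) (hDC : D ≠ C)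
    (cX : X.card = 3) (fX : fat w X = 0) (cA : A.card = 4) (cB : B.card = 4) (cC : C.card = 4)
    (cD : D.card = 4) (fA : fat w A = 0) (fB : fat w B = 0) (fC : fat w C = 0) (fD : fat w D = 0)
    (hXsub : X ⊆ D ∪ (C ∪ (B ∪ A))) (hmeet : (B ∩ A).card = 1) : False := by
  obtain ⟨eDC, eC, eD, eA, eB, xA, xB, xC, xD⟩ := meets_all_of_meet h1 h2 h3 h4 hnt hX hA hB hC hD hAX hBX hCX
    hDX hBA hCA hDA hCB hDB hDC cX fX cA cB cC cD fA fB fC fD hmeet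
  have cA' : 4 ≤ A.card := cA.ge
  have cB' : 4 ≤ B.card := cB.ge
  have cC' : 4 ≤ C.card := cC.ge
  have cD' : 4 ≤ D.card := cD.ge
  have hXsub2 : X ⊆ C ∪ (D ∪ (B ∪ A)) := by
    rw [show C ∪ (D ∪ (B ∪ A)) = D ∪ (C ∪ (B ∪ A)) by ac_rfl]; exact hXsub
  have hXsub3 : X ⊆ B ∪ (A ∪ (D ∪ C)) := by
    rw [show B ∪ (A ∪ (D ∪ C)) = D ∪ (C ∪ (B ∪ A)) by ac_rfl]; exact hXsub
  have hXsub4 : X ⊆ A ∪ (B ∪ (D ∪ C)) := by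
    rw [show A ∪ (B ∪ (D ∪ C)) = D ∪ (C ∪ (B ∪ A)) by ac_rfl]; exact hXsub
  have eCD : (C ∩ D).card = 1 := by rw [Finset.inter_comm]; exact eDC
  have eAB : (A ∩ B).card = 1 := by rw [Finset.inter_comm]; exact hmeet
  have eA' : (A ∩ (C ∪ D)).card = 1 := by rw [Finset.union_comm]; exact eA
  have eB' : (B ∩ (C ∪ D)).card = 1 := by rw [Finset.union_comm]; exact eB
  have eC'' : (C ∩ (A ∪ B)).card = 1 := by rw [Finset.union_comm]; exact eC
  have eD'' : (D ∩ (A ∪ B)).card = 1 := by rw [Finset.union_comm]; exact eD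
  -- the four vertex facts
  have z1 := vertex_not_mem h3 hnt hX hA hB hC hD hAX hBX hCX hDX hBA hCA hDA hCB hDB hDC cX cA' cB' cC' cD'
    hXsub hmeet eDC eC eD eA eB xA xB xC xD
  have z2 := vertex_not_mem h3 hnt hX hA hB hD hC hAX hBX hDX hCX hBA hDA hCA hDB hCB hDC.symm cX cA' cB' cD'
    cC' hXsub2 hmeet eCD eD eC eA' eB' xA xB xD xC
  have z3 := vertex_not_mem h3 hnt hX hC hD hA hB hCX hDX hAX hBX hDC hCA.symm hCB.symm hDA.symm hDB.symm hBA
    cX cC' cD' cA' cB' hXsub3 eDC hmeet eA eB eC eD xC xD xA xB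
  have z4 := vertex_not_mem h3 hnt hX hC hD hB hA hCX hDX hBX hAX hDC hCB.symm hCA.symm hDB.symm hDA.symm
    hBA.symm cX cC' cD' cB' cA' hXsub4 eDC eAB eB eA eC'' eD'' xC xD xB xA
  -- the cycle
  have uC := card_inter_union_add C B A
  have uD := card_inter_union_add D B A
  have uA := card_inter_union_add A D C
  have uB := card_inter_union_add B D C
  have iAC : (A ∩ C).card = (C ∩ A).card := by rw [Finset.inter_comm]
  have iAD : (A ∩ D).card = (D ∩ A).card := by rw [Finset.inter_comm]
  have iBC : (B ∩ C).card = (C ∩ B).card := by rw [Finset.inter_comm]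
  have iBD : (B ∩ D).card = (D ∩ B).card := by rw [Finset.inter_comm]
  have pCA := h3 C hC A hA hCA
  have pDA := h3 D hD A hA hDA
  rcases (by omega : ((C ∩ A).card = 1 ∧ (C ∩ B).card = 0 ∧ (D ∩ A).card = 0 ∧ (D ∩ B).card = 1) ∨
      ((D ∩ A).card = 1 ∧ (D ∩ B).card = 0 ∧ (C ∩ A).card = 0 ∧ (C ∩ B).card = 1)) with
    ⟨q1, q2, q3, q4⟩ | ⟨q1, q2, q3, q4⟩
  · exact no_transversal_cycle h1 h2 h3 h4 hX hA hB hC hD hAX hBX hCX hDX hBA hCA hDA hCB hDB hDC cX fX cA cB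
      cC cD fA fB fC hXsub hmeet eDC q1 q2 q3 q4 xA xB xC xD
  · exact no_transversal_cycle h1 h2 h3 h4 hX hA hB hD hC hAX hBX hDX hCX hBA hDA hCA hDB hCB hDC.symm cX fX cA
      cB cD cC fA fB fD hXsub2 hmeet eCD q1 q2 q3 q4 xA xB xD xC

include h1 h2 h3 h4 in
/-- **Four simple big lines with no triangle admit no 3-point line inside their union.** -/
theorem no_transversal_of_no_triangle (hnt : NoTriangle ls) {X L₁ L₂ L₃ L₄ : Finset β} (hX : X ∈ ls)
    (hL₁ : L₁ ∈ ls) (hL₂ : L₂ ∈ ls) (hL₃ : L₃ ∈ ls) (hL₄ : L₄ ∈ ls) (h1X : L₁ ≠ X) (h2X : L₂ ≠ X)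
    (h3X : L₃ ≠ X) (h4X : L₄ ≠ X) (h21 : L₂ ≠ L₁) (h31 : L₃ ≠ L₁) (h41 : L₄ ≠ L₁) (h32 : L₃ ≠ L₂)
    (h42 : L₄ ≠ L₂) (h43 : L₄ ≠ L₃) (cX : X.card = 3) (fX : fat w X = 0) (c1 : L₁.card = 4) (c2 : L₂.card = 4)
    (c3 : L₃.card = 4) (c4 : L₄.card = 4) (f1 : fat w L₁ = 0) (f2 : fat w L₂ = 0) (f3 : fat w L₃ = 0)
    (f4 : fat w L₄ = 0) (hXsub : X ⊆ L₄ ∪ (L₃ ∪ (L₂ ∪ L₁))) : False := by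
  have p21 := h3 L₂ hL₂ L₁ hL₁ h21
  have p31 := h3 L₃ hL₃ L₁ hL₁ h31
  have p41 := h3 L₄ hL₄ L₁ hL₁ h41
  have p32 := h3 L₃ hL₃ L₂ hL₂ h32
  have p42 := h3 L₄ hL₄ L₂ hL₂ h42
  have p43 := h3 L₄ hL₄ L₃ hL₃ h43
  by_cases m21 : (L₂ ∩ L₁).card = 1
  · exact no_transversal_of_meet h1 h2 h3 h4 hnt hX hL₁ hL₂ hL₃ hL₄ h1X h2X h3X h4X h21 h31 h41 h32 h42 h43 cX fX
      c1 c2 c3 c4 f1 f2 f3 f4 hXsub m21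
  by_cases m31 : (L₃ ∩ L₁).card = 1
  · exact no_transversal_of_meet h1 h2 h3 h4 hnt hX hL₁ hL₃ hL₂ hL₄ h1X h3X h2X h4X h31 h21 h41 h32.symm h43
      h42 cX fX c1 c3 c2 c4 f1 f3 f2 f4
      (by rw [show L₄ ∪ (L₂ ∪ (L₃ ∪ L₁)) = L₄ ∪ (L₃ ∪ (L₂ ∪ L₁)) by ac_rfl]; exact hXsub) m31
  by_cases m41 : (L₄ ∩ L₁).card = 1
  · exact no_transversal_of_meet h1 h2 h3 h4 hnt hX hL₁ hL₄ hL₂ hL₃ h1X h4X h2X h3X h41 h21 h31 h42.symm h43.symm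
      h32 cX fX c1 c4 c2 c3 f1 f4 f2 f3
      (by rw [show L₃ ∪ (L₂ ∪ (L₄ ∪ L₁)) = L₄ ∪ (L₃ ∪ (L₂ ∪ L₁)) by ac_rfl]; exact hXsub) m41
  by_cases m32 : (L₃ ∩ L₂).card = 1
  · exact no_transversal_of_meet h1 h2 h3 h4 hnt hX hL₂ hL₃ hL₁ hL₄ h2X h3X h1X h4X h32 h21.symm h42 h31.symm h43
      h41 cX fX c2 c3 c1 c4 f2 f3 f1 f4
      (by rw [show L₄ ∪ (L₁ ∪ (L₃ ∪ L₂)) = L₄ ∪ (L₃ ∪ (L₂ ∪ L₁)) by ac_rfl]; exact hXsub) m32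
  by_cases m42 : (L₄ ∩ L₂).card = 1
  · exact no_transversal_of_meet h1 h2 h3 h4 hnt hX hL₂ hL₄ hL₁ hL₃ h2X h4X h1X h3X h42 h21.symm h32 h41.symm
      h43.symm h31 cX fX c2 c4 c1 c3 f2 f4 f1 f3
      (by rw [show L₃ ∪ (L₁ ∪ (L₄ ∪ L₂)) = L₄ ∪ (L₃ ∪ (L₂ ∪ L₁)) by ac_rfl]; exact hXsub) m42
  by_cases m43 : (L₄ ∩ L₃).card = 1
  · exact no_transversal_of_meet h1 h2 h3 h4 hnt hX hL₃ hL₄ hL₁ hL₂ h3X h4X h1X h2X h43 h31.symm h32.symm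
      h41.symm h42.symm h21 cX fX c3 c4 c1 c2 f3 f4 f1 f2
      (by rw [show L₂ ∪ (L₁ ∪ (L₄ ∪ L₃)) = L₄ ∪ (L₃ ∪ (L₂ ∪ L₁)) by ac_rfl]; exact hXsub) m43
  exact no_transversal_of_disjoint h1 h2 h3 h4 hX hL₁ hL₂ hL₃ hL₄ h1X h2X h3X h4X h21 h31 h41 h32 h42 h43 cX fX
    c1 c2 c3 c4 f1 f2 (by omega) (by omega) (by omega) (by omega) (by omega)

end Cycle

end Eight

end FourCap

end S1

end PercRepro
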